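import Literature.NumberTheory.Automorphic.HeckeDoubleCosetOperators
import Mathlib.RingTheory.TensorProduct.Free
import HarnessLib

/-!
# Base change of the Hecke algebra of a Hecke pair: `k' ⊗_k ℋ_k(G, K) ≅ ℋ_{k'}(G, K)`
# (Treumann–Venkatesh §2.10; Shimura §3.1)

Topic `NumberTheory/Automorphic`; namespace `Literature.NumberTheory.Automorphic.heckeAlgebra` (lane `lit-hodgefound`,
Track 2 foundations; seat `lit-hodgefound-p11`, generation 42, row g42-#7).  THEOREMS ONLY: no definition, no named fact,
no instance, no notation.  For a Hecke pair `(G, K)` (`[IsHeckeTriple ⊤ K K]`: every double coset is a finite union of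
left cosets) the tree's Hecke algebra `heckeAlgebra k G K = End_G(k[G ⧸ K])` (`HeckeAlgebra`) is `k`-free on the double
cosets (`exists_basis_heckeAlgebra_holds`, coordinates `heckeAlgebra.doubleCosetCoeffEquiv`).  Here: for every commutative
`k`-algebra `k'`, **change of coefficients** `ℋ_k → ℋ_{k'}` is a `k`-algebra homomorphism acting on the vectors `T [K]`
coefficientwise and fixing every double-coset operator `T_{KgK}`, injective when `k → k'` is, and its `k'`-linear extension
**`k' ⊗_k ℋ_k(G, K) ≃ₐ[k'] ℋ_{k'}(G, K)`** is an isomorphism of `k'`-algebras (`1 ⊗ T_{KgK} ↦ T_{KgK}`); in particular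
`ℋ_{k'}(G, K) ≅ k' ⊗_ℤ ℋ_ℤ(G, K)` for every commutative ring `k'` — the Hecke algebra "is defined over `ℤ`".

## The print

[TreumannVenkatesh2016] §2.10 (arXiv p. 8): «If `S` has finitely many `G`-orbits, `Fun_G(S × S)` has a two-sided unit and
the action on `k[S]` identifies `Fun_G(S × S)` with the ring of `G`-endomorphisms of `k[S]`.  The standard example is when
`K ⊂ G` is an open compact subgroup and `S = G/K`.  In that case, `Fun_G(G/K × G/K)` can be identified with finitely supported
functions on the double coset space `K\G/K` […] We will also use the notation `ℋ(G, K; 𝐅_q)` for that subalgebra of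
`ℋ(G, K)` consisting of functions valued in `𝐅_q ⊂ k`»; [Shimura1971] §3.1 (the Hecke ring `R(Γ, Δ)` is the free
`ℤ`-module on the double cosets `ΓαΓ`, with the same structure constants over any coefficient ring).  Since the structure
constants of `End_G(k[G ⧸ K])` in the double-coset basis are the images of integers, the identification of the double-coset
bases gives `k' ⊗_k ℋ_k ≅ ℋ_{k'}` and the sub-`k`-algebra `ℋ(G, K; k) ⊆ ℋ(G, K; k')` for `k ⊆ k'`.

## What is formalised (theorems only; namespace `heckeAlgebra`)

* §1 coefficient change on `k[G ⧸ K]`: `map_ofMulAction` (it commutes with the `G`-action), `map_smul_algebraMap`,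
  `map_doubleCosetIndicator`.
* §2 **`exists_algHom_toVector_eq_map`**: a `k`-algebra homomorphism `ψ : ℋ_k(G, K) →ₐ[k] ℋ_{k'}(G, K)` with
  `(ψ T) [K] = map (T [K])`; any such `ψ` fixes the double-coset operators (`apply_doubleCosetOperator_of_toVector_eq_map`),
  is injective when `algebraMap k k'` is (`injective_of_toVector_eq_map`, T–V's `ℋ(G, K; 𝐅_q) ⊆ ℋ(G, K; k)`), and acts on
  the double-coset coordinates by `Finsupp.mapRange` (`doubleCosetCoeffEquiv_apply_of_toVector_eq_map`).
* §3 **`exists_algEquiv_baseChange`**: `k' ⊗[k] ℋ_k(G, K) ≃ₐ[k'] ℋ_{k'}(G, K)` with `c ⊗ T_{KgK} ↦ c • T_{KgK}`;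
  **`exists_algEquiv_baseChange_int`**: `k' ⊗[ℤ] ℋ_ℤ(G, K) ≃ₐ[k'] ℋ_{k'}(G, K)`.

## References
* [TreumannVenkatesh2016] D. Treumann, A. Venkatesh, *Functoriality, Smith theory, and the Brauer homomorphism*,
  Ann. of Math. 183 (2016), §2.10.
* [Shimura1971] G. Shimura, *Introduction to the Arithmetic Theory of Automorphic Functions* (1971), §3.1.
-/

noncomputable section

open scoped TensorProduct
open MonoidAlgebra Representation

namespace Literature.NumberTheory.Automorphic

namespace heckeAlgebra

variable {k k' G : Type*} [CommRing k] [CommRing k'] [Algebra k k'] [Group G] (K : Subgroup G)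

/-! ## §1 Change of coefficients on `k[G ⧸ K]` -/

/-- Change of coefficients commutes with the permutation action of `G` on `k[G ⧸ K]`. [folklore]
[cite: TreumannVenkatesh2016, §2.10] -/
theorem map_ofMulAction (g : G) (v : MonoidAlgebra k (G ⧸ K)) :
    MonoidAlgebra.map (algebraMap k k').toAddMonoidHom (ofMulAction k G (G ⧸ K) g v) =
      ofMulAction k' G (G ⧸ K) g (MonoidAlgebra.map (algebraMap k k').toAddMonoidHom v) := by
  induction v using MonoidAlgebra.induction_linear with
  | zero => simp
  | add x y hx hy => rw [map_add, MonoidAlgebra.map_add, hx, hy, MonoidAlgebra.map_add, map_add]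
  | single x r => rw [ofMulAction_single, MonoidAlgebra.map_single, MonoidAlgebra.map_single, ofMulAction_single]

/-- Change of coefficients is `k`-semilinear: `map (c • v) = algebraMap c • map v`. [folklore]
[cite: TreumannVenkatesh2016, §2.10] -/
theorem map_smul_algebraMap (c : k) (v : MonoidAlgebra k (G ⧸ K)) :
    MonoidAlgebra.map (algebraMap k k').toAddMonoidHom (c • v) =
      algebraMap k k' c • MonoidAlgebra.map (algebraMap k k').toAddMonoidHom v := by
  refine MonoidAlgebra.ext (Finsupp.ext fun x => ?_)
  simp [MonoidAlgebra.coeff_smul, Algebra.smul_def]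

variable [IsHeckeTriple (⊤ : Submonoid G) K K]

/-- The indicator vector `𝟙_{KgK}` has coefficients `0, 1`, so it is preserved by change of coefficients. [folklore]
[cite: TreumannVenkatesh2016, §2.10] -/
theorem map_doubleCosetIndicator (g : G) :
    MonoidAlgebra.map (algebraMap k k').toAddMonoidHom (doubleCosetIndicator k G K g) = doubleCosetIndicator k' G K g := by
  rw [doubleCosetIndicator_eq_sum, doubleCosetIndicator_eq_sum, MonoidAlgebra.map_sum]
  exact Finset.sum_congr rfl fun γ _ => by rw [MonoidAlgebra.map_single, RingHom.toAddMonoidHom_eq_coe, AddMonoidHom.coe_coe, map_one]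

/-! ## §2 The change-of-coefficients homomorphism `ℋ_k(G, K) → ℋ_{k'}(G, K)` -/

omit [IsHeckeTriple (⊤ : Submonoid G) K K] in
/-- **Change of coefficients `ℋ_k(G, K) →ₐ[k] ℋ_{k'}(G, K)`**: there is a `k`-algebra homomorphism `ψ` with
`(ψ T) [K] = map (T [K])` (coefficientwise `algebraMap k k'`) — namely `T ↦ extend (map (T [K]))`; it is multiplicative by the
product rule `(S T) [K] = ∑_γ (T [K])(γ) · γ̃ · (S [K])` (`toVector_mul_eq_sum`), whose right-hand side commutes with change of
coefficients. [cite: TreumannVenkatesh2016, §2.10] [cite: Shimura1971, §3.1] -/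
theorem exists_algHom_toVector_eq_map :
    ∃ ψ : heckeAlgebra k G K →ₐ[k] heckeAlgebra k' G K,
      ∀ T, toVector K (ψ T) = MonoidAlgebra.map (algebraMap k k').toAddMonoidHom (toVector K T) := by
  classical
  -- the underlying function and its `K`-invariance
  have hinv : ∀ T : heckeAlgebra k G K, ∀ a ∈ K, ofMulAction k' G (G ⧸ K) a
      (MonoidAlgebra.map (algebraMap k k').toAddMonoidHom (toVector K T)) =
        MonoidAlgebra.map (algebraMap k k').toAddMonoidHom (toVector K T) := fun T a ha => by
    rw [← map_ofMulAction, ofMulAction_toVector K T ha]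
  let ψ₀ : heckeAlgebra k G K → heckeAlgebra k' G K := fun T =>
    ofVector K (MonoidAlgebra.map (algebraMap k k').toAddMonoidHom (toVector K T)) (hinv T)
  have hψ₀ : ∀ T, toVector K (ψ₀ T) = MonoidAlgebra.map (algebraMap k k').toAddMonoidHom (toVector K T) := fun T =>
    toVector_ofVector K _ _
  -- `k`-linearity
  let ψ₁ : heckeAlgebra k G K →ₗ[k] heckeAlgebra k' G K :=
    { toFun := ψ₀
      map_add' := fun S T => toVector_injective K (by
        rw [map_add, hψ₀, hψ₀, hψ₀, map_add, MonoidAlgebra.map_add])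
      map_smul' := fun c T => toVector_injective K (by
        rw [RingHom.id_apply, hψ₀, map_smul, map_smul_algebraMap, ← algebraMap_smul k' c (ψ₀ T), map_smul, hψ₀]) }
  have hψ₁ : ∀ T, toVector K (ψ₁ T) = MonoidAlgebra.map (algebraMap k k').toAddMonoidHom (toVector K T) := hψ₀
  -- unit and product
  have h1 : ψ₁ 1 = 1 := toVector_injective K (by
    rw [hψ₁, toVector_one, toVector_one, MonoidAlgebra.map_single, RingHom.toAddMonoidHom_eq_coe, AddMonoidHom.coe_coe, map_one])
  have hmul : ∀ S T, ψ₁ (S * T) = ψ₁ S * ψ₁ T := fun S T => toVector_injective K (by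
    rw [hψ₁, toVector_mul_eq_sum, toVector_mul_eq_sum, MonoidAlgebra.map_sum, hψ₁ S, hψ₁ T]
    -- compare the two sums: the second runs over the (possibly smaller) support of `map (T [K])`
    symm
    refine Finset.sum_subset (fun γ hγ => ?_) (fun γ _ hγ => ?_) |>.trans (Finset.sum_congr rfl fun γ _ => ?_)
    · rw [Finsupp.mem_support_iff] at hγ ⊢
      intro h0
      apply hγ
      rw [MonoidAlgebra.coeff_map, Finsupp.mapRange_apply, h0, RingHom.toAddMonoidHom_eq_coe, AddMonoidHom.coe_coe, map_zero]
    · rw [Finsupp.notMem_support_iff] at hγ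
      rw [hγ, zero_smul]
    · rw [map_smul_algebraMap, map_ofMulAction]
      simp only [MonoidAlgebra.coeff_map, Finsupp.mapRange_apply, RingHom.toAddMonoidHom_eq_coe, AddMonoidHom.coe_coe])
  refine ⟨AlgHom.ofLinearMap ψ₁ h1 hmul, fun T => ?_⟩
  exact hψ₁ T

/-- A change-of-coefficients homomorphism fixes every double-coset operator: `ψ(T_{KgK}) = T_{KgK}`.
[cite: TreumannVenkatesh2016, §2.10] [cite: Shimura1971, §3.1] -/
theorem apply_doubleCosetOperator_of_toVector_eq_map {ψ : heckeAlgebra k G K →ₐ[k] heckeAlgebra k' G K}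
    (hψ : ∀ T, toVector K (ψ T) = MonoidAlgebra.map (algebraMap k k').toAddMonoidHom (toVector K T)) (g : G) :
    ψ (doubleCosetOperator (k := k) K g) = doubleCosetOperator (k := k') K g :=
  toVector_injective K (by rw [hψ, toVector_doubleCosetOperator, toVector_doubleCosetOperator, map_doubleCosetIndicator])

omit [IsHeckeTriple (⊤ : Submonoid G) K K] in
/-- **`ℋ(G, K; k) ⊆ ℋ(G, K; k')`**: a change-of-coefficients homomorphism is injective when `k → k'` is.
[cite: TreumannVenkatesh2016, §2.10] -/
theorem injective_of_toVector_eq_map {ψ : heckeAlgebra k G K →ₐ[k] heckeAlgebra k' G K}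
    (hψ : ∀ T, toVector K (ψ T) = MonoidAlgebra.map (algebraMap k k').toAddMonoidHom (toVector K T))
    (hinj : Function.Injective (algebraMap k k')) : Function.Injective ψ := fun S T h =>
  toVector_injective K (MonoidAlgebra.map_injective _ hinj (by rw [← hψ, ← hψ, h]))

/-- In the double-coset coordinates `doubleCosetCoeffEquiv`, a change-of-coefficients homomorphism is `Finsupp.mapRange`.
[cite: Shimura1971, §3.1] -/
theorem doubleCosetCoeffEquiv_apply_of_toVector_eq_map {ψ : heckeAlgebra k G K →ₐ[k] heckeAlgebra k' G K}
    (hψ : ∀ T, toVector K (ψ T) = MonoidAlgebra.map (algebraMap k k').toAddMonoidHom (toVector K T))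
    (T : heckeAlgebra k G K) :
    doubleCosetCoeffEquiv K (ψ T) = Finsupp.mapRange (algebraMap k k') (map_zero _) (doubleCosetCoeffEquiv K T) := by
  refine Finsupp.ext fun D => ?_
  rw [doubleCosetCoeffEquiv_apply, doubleCosetCoeff_apply, ← toVector_apply, hψ, MonoidAlgebra.coeff_map,
    Finsupp.mapRange_apply, Finsupp.mapRange_apply, doubleCosetCoeffEquiv_apply, doubleCosetCoeff_apply, ← toVector_apply]
  rfl

/-- A change-of-coefficients homomorphism carries the double-coset basis of `ℋ_k` to that of `ℋ_{k'}`.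
[cite: Shimura1971, §3.1] -/
theorem apply_basis_ofRepr_of_toVector_eq_map {ψ : heckeAlgebra k G K →ₐ[k] heckeAlgebra k' G K}
    (hψ : ∀ T, toVector K (ψ T) = MonoidAlgebra.map (algebraMap k k').toAddMonoidHom (toVector K T))
    (D : HeckeCoset (⊤ : Submonoid G) K K) :
    ψ (Module.Basis.ofRepr (doubleCosetCoeffEquiv (k := k) K) D) =
      Module.Basis.ofRepr (doubleCosetCoeffEquiv (k := k') K) D := by
  apply (Module.Basis.ofRepr (doubleCosetCoeffEquiv (k := k') K)).repr.injective
  rw [Module.Basis.repr_self]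
  change doubleCosetCoeffEquiv K (ψ _) = _
  rw [doubleCosetCoeffEquiv_apply_of_toVector_eq_map K hψ]
  change Finsupp.mapRange _ _ ((Module.Basis.ofRepr (doubleCosetCoeffEquiv (k := k) K)).repr
    (Module.Basis.ofRepr (doubleCosetCoeffEquiv (k := k) K) D)) = _
  rw [Module.Basis.repr_self, Finsupp.mapRange_single, map_one]

/-! ## §3 `k' ⊗_k ℋ_k(G, K) ≃ₐ[k'] ℋ_{k'}(G, K)` -/

/-- **BASE CHANGE OF THE HECKE ALGEBRA OF A HECKE PAIR**: for every commutative `k`-algebra `k'` there is an isomorphism of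
`k'`-algebras `k' ⊗_k ℋ_k(G, K) ≃ₐ[k'] ℋ_{k'}(G, K)` with `c ⊗ T_{KgK} ↦ c · T_{KgK}` — the `k'`-linear extension
(`Algebra.TensorProduct.lift`) of the change of coefficients, bijective because it carries the double-coset basis
`1 ⊗ T_D` of `k' ⊗_k ℋ_k` (`Algebra.TensorProduct.basis`) to the double-coset basis of `ℋ_{k'}`.
[cite: TreumannVenkatesh2016, §2.10] [cite: Shimura1971, §3.1] -/
theorem exists_algEquiv_baseChange :
    ∃ e : k' ⊗[k] heckeAlgebra k G K ≃ₐ[k'] heckeAlgebra k' G K,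
      ∀ (c : k') (g : G), e (c ⊗ₜ doubleCosetOperator (k := k) K g) = c • doubleCosetOperator (k := k') K g := by
  obtain ⟨ψ, hψ⟩ := exists_algHom_toVector_eq_map (k := k) (k' := k') K
  let Φ : k' ⊗[k] heckeAlgebra k G K →ₐ[k'] heckeAlgebra k' G K :=
    Algebra.TensorProduct.lift (Algebra.ofId k' _) ψ fun a b => Algebra.commutes a (ψ b)
  have hΦ : ∀ (c : k') (T : heckeAlgebra k G K), Φ (c ⊗ₜ T) = c • ψ T := fun c T => by
    rw [Algebra.TensorProduct.lift_tmul, Algebra.ofId_apply, ← Algebra.smul_def]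
  -- `Φ` carries the basis `1 ⊗ T_D` to the basis `T_D`
  let b := Module.Basis.ofRepr (doubleCosetCoeffEquiv (k := k) K)
  let b' := Module.Basis.ofRepr (doubleCosetCoeffEquiv (k := k') K)
  have hb : ∀ D, Φ (Algebra.TensorProduct.basis k' b D) = b' D := fun D => by
    rw [Algebra.TensorProduct.basis_apply, hΦ, one_smul]
    exact apply_basis_ofRepr_of_toVector_eq_map K hψ D
  have hlin : Φ.toLinearMap = ((Algebra.TensorProduct.basis k' b).equiv b' (Equiv.refl _)).toLinearMap :=
    (Algebra.TensorProduct.basis k' b).ext fun D => by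
      rw [AlgHom.toLinearMap_apply, hb, LinearEquiv.coe_toLinearMap, Module.Basis.equiv_apply, Equiv.refl_apply]
  have hbij : Function.Bijective Φ := by
    change Function.Bijective Φ.toLinearMap
    rw [hlin]
    exact LinearEquiv.bijective _
  refine ⟨AlgEquiv.ofBijective Φ hbij, fun c g => ?_⟩
  rw [AlgEquiv.ofBijective_apply, hΦ, apply_doubleCosetOperator_of_toVector_eq_map K hψ]

/-- **`ℋ_{k'}(G, K) ≅ k' ⊗_ℤ ℋ_ℤ(G, K)`**: the Hecke algebra of a Hecke pair is defined over `ℤ`.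
[cite: Shimura1971, §3.1] [cite: TreumannVenkatesh2016, §2.10] -/
theorem exists_algEquiv_baseChange_int :
    ∃ e : k' ⊗[ℤ] heckeAlgebra ℤ G K ≃ₐ[k'] heckeAlgebra k' G K,
      ∀ (c : k') (g : G), e (c ⊗ₜ doubleCosetOperator (k := ℤ) K g) = c • doubleCosetOperator (k := k') K g :=
  exists_algEquiv_baseChange (k := ℤ) (k' := k') K

end heckeAlgebra

end Literature.NumberTheory.Automorphic

end
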